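import Mathlib
import Summits.MatrixMultiplication.MatrixMultiplication.Theorems.SubgroupIdentityDesigns.Negative.BorelFamilyF

/-!
# Volume ceiling `|H₁||H₂||H₃| ≤ (p-1)⁴` for subgroup-TPP triples in a Borel of `GL₂(𝔽_p)`
(structural / negative lemma for the crux `SubgroupIdentityDesigns`,
stmt-MatrixMultiplication-14079;
cell B2b-5, gen 6 — report `run/shared/lean/b2b/levelgraded-cu/ORACLE-g6.md` §G6-2)

Every level-one subgroup identity design of `GL₂(𝔽_p)` found so far (gen 5: `p = 11`; gen 6: the
infinite families `borelFamily`, `diagFamily`) consists of three subgroups of a Borel subgroup.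
* `borel_tpp_volume_le` — for a prime `p ≥ 3` and subgroups `H₁, H₂, H₃` of the upper Borel
  (`h 1 0 = 0`) with `Literature.Barriers.MatrixMultiplication.SubgroupTPP`:
  `|H₁| |H₂| |H₃| ≤ (p-1)⁴` (false at `p = 2`: `(U, 1, 1)` has volume `2`).
Proof (elementary).  `x(h) = h₀₀`, `z(h) = h₁₁`.  Case A (`volume_le_of_noUnipotent`, no `Hᵢ`
contains a non-trivial unipotent): `(h₁,h₂,h₃) ↦ (z₁/x₁, z₂/x₂, z₃/x₃, x₁x₂x₃) ∈ (𝔽_pˣ)⁴` is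
injective — equal images make `aᵢ = hᵢ'⁻¹hᵢ ∈ Hᵢ` scalar-diagonal with `∏ x(aᵢ) = 1`, so
`w = a₁a₂a₃` is unipotent (`wᵖ = 1`), the `aᵢ` commute and `w^{p-1} = ∏ aᵢ^{p-1} = 1` since
`aᵢ^{p-1} ∈ Hᵢ` is unipotent by Fermat; hence `w = 1` and the TPP gives `aᵢ = 1`
(`key_noUnipotent`).  Case B (`volume_le_of_unipotent`, some `Hᵢ` — by `SubgroupTPP.rotate`
`H₁` — contains a non-trivial unipotent, hence all of `U`, `unipUpper_mem_of_mem`):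
`(h₁,h₂,h₃) ↦ (x₁x₂x₃, z₁z₂z₃, (h₁)₀₁) ∈ 𝔽_pˣ × 𝔽_pˣ × 𝔽_p` is injective (`w ∈ U ≤ H₁` and the
TPP on `(w⁻¹a₁) a₂ a₃ = 1`, `key_unipotent`), so `V ≤ p(p-1)² ≤ (p-1)⁴`.
Consequence for the crux at `(m,k) = (2,1)`: a Borel triple needs `budget < (p-1)^{4(2+ε)/3}`;
with the level-one budget `1 + p^{2+ε} + (p-2)(p+1)^{2+ε}` (paper; tree upper bound
`LevelOneLink.levelOne_budget_le`) this fails for all `ε ≤ 1` — Borel triples certify the crux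
body only for `ε > 1` (numerically `ε > 6.0025`, `p = 241`, `diagFamily`), never near `ω`.  The
bound is attained up to arithmetic constraints by `diagFamily` (`V = (p-1)²|R₂||R₃|`).
Sorry-free; axioms `propext`, `Classical.choice`, `Quot.sound`.  VALUE = a structural theorem
about one configuration class, NOT summit progress; the crux item stays open and untouched.
-/

set_option linter.dupNamespace false

noncomputable section

open scoped BigOperators Classical
open Summit.MatrixMultiplication.MatrixMultiplication.Theorems.LieRankDesigns.Negative (GLm Mat)

namespace Summit.MatrixMultiplication.MatrixMultiplication.Theorems.SubgroupIdentityDesigns.Negative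

variable {p : ℕ} [Fact p.Prime]

section VolumeBound

open Literature.Barriers.MatrixMultiplication (SubgroupTPP)

/-- The `(0,0)` entry is multiplicative when the right factor is upper triangular. -/
theorem upper_mul_apply00 {a b : GLm p 2} (hb : (b : Mat p 2) 1 0 = 0) :
    ((a * b : GLm p 2) : Mat p 2) 0 0 = (a : Mat p 2) 0 0 * (b : Mat p 2) 0 0 := by
  rw [Units.val_mul, Matrix.mul_apply, Fin.sum_univ_two, hb, mul_zero, add_zero]

/-- The `(1,1)` entry is multiplicative when the left factor is upper triangular. -/
theorem upper_mul_apply11 {a b : GLm p 2} (ha : (a : Mat p 2) 1 0 = 0) :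
    ((a * b : GLm p 2) : Mat p 2) 1 1 = (a : Mat p 2) 1 1 * (b : Mat p 2) 1 1 := by
  rw [Units.val_mul, Matrix.mul_apply, Fin.sum_univ_two, ha, zero_mul, zero_add]

/-- The diagonal entries of an upper-triangular element of `GL₂` are non-zero. -/
theorem upper_diag_ne_zero (g : GLm p 2) (hg : (g : Mat p 2) 1 0 = 0) :
    (g : Mat p 2) 0 0 ≠ 0 ∧ (g : Mat p 2) 1 1 ≠ 0 := by
  have hdet : (g : Mat p 2).det ≠ 0 := by
    rw [← Matrix.GeneralLinearGroup.val_det_apply]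
    exact (Matrix.GeneralLinearGroup.det g).ne_zero
  rw [Matrix.det_fin_two, hg, mul_zero, sub_zero] at hdet
  exact mul_ne_zero_iff.mp hdet

/-- Upper-triangular elements are determined by their three entries. -/
theorem upper_ext {g h : GLm p 2} (hg : (g : Mat p 2) 1 0 = 0) (hh : (h : Mat p 2) 1 0 = 0)
    (h00 : (g : Mat p 2) 0 0 = (h : Mat p 2) 0 0) (h01 : (g : Mat p 2) 0 1 = (h : Mat p 2) 0 1)
    (h11 : (g : Mat p 2) 1 1 = (h : Mat p 2) 1 1) : g = h := by
  apply Units.ext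
  ext i j
  fin_cases i <;> fin_cases j
  · simpa using h00
  · simpa using h01
  · simpa [hh] using hg
  · simpa using h11

/-- Powers of an upper-triangular element are upper triangular. -/
theorem upper_pow {g : GLm p 2} (hg : (g : Mat p 2) 1 0 = 0) (n : ℕ) :
    ((g ^ n : GLm p 2) : Mat p 2) 1 0 = 0 := by
  induction n with
  | zero => simp
  | succ n ih => rw [pow_succ]; exact upper_mul ih hg

/-- `(gⁿ)₀₀ = (g₀₀)ⁿ` for upper-triangular `g`. -/
theorem upper_pow_apply00 {g : GLm p 2} (hg : (g : Mat p 2) 1 0 = 0) (n : ℕ) :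
    ((g ^ n : GLm p 2) : Mat p 2) 0 0 = ((g : Mat p 2) 0 0) ^ n := by
  induction n with
  | zero => simp
  | succ n ih => rw [pow_succ, upper_mul_apply00 hg, ih, pow_succ]

/-- `(gⁿ)₁₁ = (g₁₁)ⁿ` for upper-triangular `g`. -/
theorem upper_pow_apply11 {g : GLm p 2} (hg : (g : Mat p 2) 1 0 = 0) (n : ℕ) :
    ((g ^ n : GLm p 2) : Mat p 2) 1 1 = ((g : Mat p 2) 1 1) ^ n := by
  induction n with
  | zero => simp
  | succ n ih => rw [pow_succ, upper_mul_apply11 (upper_pow hg n), ih, pow_succ]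

/-- Entries of the quotient `h'⁻¹ h` of two elements of an upper-triangular subgroup. -/
theorem quot_apply {H : Subgroup (GLm p 2)} (hH : ∀ h ∈ H, (h : Mat p 2) 1 0 = 0) (h h' : H) :
    (((h'⁻¹ * h : H) : GLm p 2) : Mat p 2) 0 0 =
        (((h' : GLm p 2) : Mat p 2) 0 0)⁻¹ * ((h : GLm p 2) : Mat p 2) 0 0 ∧
      (((h'⁻¹ * h : H) : GLm p 2) : Mat p 2) 1 1 =
        (((h' : GLm p 2) : Mat p 2) 1 1)⁻¹ * ((h : GLm p 2) : Mat p 2) 1 1 := by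
  have hu := hH _ h'.2
  have hu' : (((h'⁻¹ : H) : GLm p 2) : Mat p 2) 1 0 = 0 := hH _ (h'⁻¹).2
  have i00 : (((h'⁻¹ : H) : GLm p 2) : Mat p 2) 0 0 = (((h' : GLm p 2) : Mat p 2) 0 0)⁻¹ := by
    have e := upper_mul_apply00 (a := ((h'⁻¹ : H) : GLm p 2)) (b := (h' : GLm p 2)) hu
    rw [Subgroup.coe_inv, inv_mul_cancel, Units.val_one, Matrix.one_apply_eq] at e
    rw [Subgroup.coe_inv]; exact eq_inv_of_mul_eq_one_left e.symm
  have i11 : (((h'⁻¹ : H) : GLm p 2) : Mat p 2) 1 1 = (((h' : GLm p 2) : Mat p 2) 1 1)⁻¹ := by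
    have e := upper_mul_apply11 (a := ((h'⁻¹ : H) : GLm p 2)) (b := (h' : GLm p 2)) hu'
    rw [Subgroup.coe_inv, inv_mul_cancel, Units.val_one, Matrix.one_apply_eq] at e
    rw [Subgroup.coe_inv]; exact eq_inv_of_mul_eq_one_left e.symm
  constructor
  · rw [Subgroup.coe_mul, upper_mul_apply00 (hH _ h.2), i00]
  · rw [Subgroup.coe_mul, upper_mul_apply11 hu', i11]

/-- Upper-triangular elements with scalar diagonal commute with each other. [folklore] -/
theorem commute_of_scalar_diag {a b : GLm p 2} (ha : (a : Mat p 2) 1 0 = 0)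
    (hb : (b : Mat p 2) 1 0 = 0) (ha' : (a : Mat p 2) 0 0 = (a : Mat p 2) 1 1)
    (hb' : (b : Mat p 2) 0 0 = (b : Mat p 2) 1 1) : Commute a b := by
  have key : (a : Mat p 2) * (b : Mat p 2) = (b : Mat p 2) * (a : Mat p 2) := by
    ext i j
    fin_cases i <;> fin_cases j <;>
      simp [Matrix.mul_apply, Fin.sum_univ_two, ha, hb, ha', hb'] <;> ring
  show a * b = b * a
  exact Units.ext (by rw [Units.val_mul, Units.val_mul]; exact key)

/-- `u(y) u(y') = u(y + y')`. -/
theorem unipUpper_mul_unipUpper (y y' : ZMod p) :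
    unipUpper y * unipUpper y' = unipUpper (y + y') := by
  rw [unipUpper_eq_upperTri, unipUpper_eq_upperTri, unipUpper_eq_upperTri, upperTri_mul]
  simp only [one_mul, mul_one, Units.val_one]
  rw [add_comm]

/-- `u(y)ⁿ = u(n y)`. -/
theorem unipUpper_pow_eq (y : ZMod p) (n : ℕ) :
    unipUpper y ^ n = unipUpper ((n : ZMod p) * y) := by
  induction n with
  | zero => rw [pow_zero, Nat.cast_zero, zero_mul, unipUpper_eq_upperTri, upperTri_one]
  | succ n ih => rw [pow_succ, ih, unipUpper_mul_unipUpper, Nat.cast_succ, add_mul, one_mul]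

/-- An upper-triangular element with unit diagonal satisfies `gᵖ = 1`. -/
theorem pow_card_eq_one_of_unipotent {g : GLm p 2} (hg : (g : Mat p 2) 1 0 = 0)
    (h00 : (g : Mat p 2) 0 0 = 1) (h11 : (g : Mat p 2) 1 1 = 1) : g ^ p = 1 := by
  rw [eq_unipUpper_of_entries g hg h00 rfl h11, unipUpper_pow_eq, ZMod.natCast_self, zero_mul,
    unipUpper_eq_upperTri, upperTri_one]

/-- A subgroup containing one non-trivial unipotent contains the whole root group `{u(y)}`. -/
theorem unipUpper_mem_of_mem {H : Subgroup (GLm p 2)} {g : GLm p 2} (hgH : g ∈ H)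
    (hg : (g : Mat p 2) 1 0 = 0) (h00 : (g : Mat p 2) 0 0 = 1) (h11 : (g : Mat p 2) 1 1 = 1)
    (hg1 : g ≠ 1) (y : ZMod p) : unipUpper y ∈ H := by
  set y₀ : ZMod p := (g : Mat p 2) 0 1 with hy₀_def
  have hgy : g = unipUpper y₀ := eq_unipUpper_of_entries g hg h00 rfl h11
  have hy₀ : y₀ ≠ 0 := fun h0 =>
    hg1 (eq_one_of_entries g hg h00 (by rw [← hy₀_def, h0]) h11)
  have : unipUpper y = g ^ (y * y₀⁻¹).val := by
    rw [hgy, unipUpper_pow_eq, ZMod.natCast_zmod_val, inv_mul_cancel_right₀ hy₀]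
  rw [this]
  exact H.pow_mem hgH _

/-- **Key lemma A** (no unipotents).  If no `Hᵢ` contains a non-trivial unipotent and
`aᵢ ∈ Hᵢ` have scalar diagonals `cᵢ` with `c₁ c₂ c₃ = 1`, then `a₁ = a₂ = a₃ = 1`: the product
`w = a₁a₂a₃` is unipotent, so `wᵖ = 1`, while `w^{p-1} = a₁^{p-1} a₂^{p-1} a₃^{p-1} = 1` (the
`aᵢ` commute, and `aᵢ^{p-1} ∈ Hᵢ` is unipotent by Fermat, hence trivial); so `w = 1`, then TPP. -/
theorem key_noUnipotent {H₁ H₂ H₃ : Subgroup (GLm p 2)}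
    (hH₁ : ∀ h ∈ H₁, (h : Mat p 2) 1 0 = 0) (hH₂ : ∀ h ∈ H₂, (h : Mat p 2) 1 0 = 0)
    (hH₃ : ∀ h ∈ H₃, (h : Mat p 2) 1 0 = 0)
    (hA₁ : ∀ h ∈ H₁, (h : Mat p 2) 0 0 = 1 → (h : Mat p 2) 1 1 = 1 → h = 1)
    (hA₂ : ∀ h ∈ H₂, (h : Mat p 2) 0 0 = 1 → (h : Mat p 2) 1 1 = 1 → h = 1)
    (hA₃ : ∀ h ∈ H₃, (h : Mat p 2) 0 0 = 1 → (h : Mat p 2) 1 1 = 1 → h = 1)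
    (htpp : SubgroupTPP H₁ H₂ H₃) {a₁ a₂ a₃ : GLm p 2} (ha₁ : a₁ ∈ H₁) (ha₂ : a₂ ∈ H₂)
    (ha₃ : a₃ ∈ H₃) (hd₁ : (a₁ : Mat p 2) 0 0 = (a₁ : Mat p 2) 1 1)
    (hd₂ : (a₂ : Mat p 2) 0 0 = (a₂ : Mat p 2) 1 1) (hd₃ : (a₃ : Mat p 2) 0 0 = (a₃ : Mat p 2) 1 1)
    (hprod : (a₁ : Mat p 2) 0 0 * (a₂ : Mat p 2) 0 0 * (a₃ : Mat p 2) 0 0 = 1) :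
    a₁ = 1 ∧ a₂ = 1 ∧ a₃ = 1 := by
  have hp1 : 1 ≤ p := (Fact.out : p.Prime).one_lt.le
  have u₁ := hH₁ a₁ ha₁
  have u₂ := hH₂ a₂ ha₂
  have u₃ := hH₃ a₃ ha₃
  have ferm : ∀ {H : Subgroup (GLm p 2)} {a : GLm p 2}, (∀ h ∈ H, (h : Mat p 2) 1 0 = 0) →
      (∀ h ∈ H, (h : Mat p 2) 0 0 = 1 → (h : Mat p 2) 1 1 = 1 → h = 1) → a ∈ H →
      a ^ (p - 1) = 1 := by
    intro H a hH hA ha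
    have hu := hH a ha
    obtain ⟨hx, hz⟩ := upper_diag_ne_zero a hu
    exact hA _ (H.pow_mem ha _) (by rw [upper_pow_apply00 hu, ZMod.pow_card_sub_one_eq_one hx])
      (by rw [upper_pow_apply11 hu, ZMod.pow_card_sub_one_eq_one hz])
  set w : GLm p 2 := a₁ * a₂ * a₃ with hw_def
  have hw10 : (w : Mat p 2) 1 0 = 0 := upper_mul (upper_mul u₁ u₂) u₃
  have hw00 : (w : Mat p 2) 0 0 = 1 := by
    rw [hw_def, upper_mul_apply00 u₃, upper_mul_apply00 u₂, hprod]
  have hw11 : (w : Mat p 2) 1 1 = 1 := by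
    rw [hw_def, upper_mul_apply11 (upper_mul u₁ u₂), upper_mul_apply11 u₁, ← hd₁, ← hd₂, ← hd₃,
      hprod]
  have hwp : w ^ p = 1 := pow_card_eq_one_of_unipotent hw10 hw00 hw11
  have c₂₃ : Commute a₂ a₃ := commute_of_scalar_diag u₂ u₃ hd₂ hd₃
  have c₁₂₃ : Commute a₁ (a₂ * a₃) := by
    refine commute_of_scalar_diag u₁ (upper_mul u₂ u₃) hd₁ ?_
    rw [upper_mul_apply00 u₃, upper_mul_apply11 u₂, hd₂, hd₃]
  have hwp1 : w ^ (p - 1) = 1 := by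
    rw [hw_def, mul_assoc, c₁₂₃.mul_pow, c₂₃.mul_pow, ferm hH₁ hA₁ ha₁, ferm hH₂ hA₂ ha₂,
      ferm hH₃ hA₃ ha₃, one_mul, one_mul]
  have hw1 : w = 1 := by
    have : w ^ p = w ^ (p - 1) * w := by rw [← pow_succ, Nat.sub_add_cancel hp1]
    rw [hwp, hwp1, one_mul] at this
    exact this.symm
  exact htpp a₁ ha₁ a₂ ha₂ a₃ ha₃ (by rw [← hw_def]; exact hw1)

/-- **Key lemma B** (`U ≤ H₁`).  If `H₁` contains every unipotent `u(y)` and `aᵢ ∈ Hᵢ` have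
`∏ (aᵢ)₀₀ = ∏ (aᵢ)₁₁ = 1`, then `a₂ = a₃ = 1` and `a₁` is unipotent: `w = a₁a₂a₃ ∈ U ≤ H₁`, and
the TPP applies to `(w⁻¹a₁) a₂ a₃ = 1`. -/
theorem key_unipotent {H₁ H₂ H₃ : Subgroup (GLm p 2)}
    (hH₁ : ∀ h ∈ H₁, (h : Mat p 2) 1 0 = 0) (hH₂ : ∀ h ∈ H₂, (h : Mat p 2) 1 0 = 0)
    (hH₃ : ∀ h ∈ H₃, (h : Mat p 2) 1 0 = 0) (hU : ∀ y : ZMod p, unipUpper y ∈ H₁)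
    (htpp : SubgroupTPP H₁ H₂ H₃) {a₁ a₂ a₃ : GLm p 2} (ha₁ : a₁ ∈ H₁) (ha₂ : a₂ ∈ H₂)
    (ha₃ : a₃ ∈ H₃) (hx : (a₁ : Mat p 2) 0 0 * (a₂ : Mat p 2) 0 0 * (a₃ : Mat p 2) 0 0 = 1)
    (hz : (a₁ : Mat p 2) 1 1 * (a₂ : Mat p 2) 1 1 * (a₃ : Mat p 2) 1 1 = 1) :
    a₂ = 1 ∧ a₃ = 1 ∧ (a₁ : Mat p 2) 0 0 = 1 ∧ (a₁ : Mat p 2) 1 1 = 1 := by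
  have u₁ := hH₁ a₁ ha₁
  have u₂ := hH₂ a₂ ha₂
  have u₃ := hH₃ a₃ ha₃
  set w : GLm p 2 := a₁ * a₂ * a₃ with hw_def
  have hw10 : (w : Mat p 2) 1 0 = 0 := upper_mul (upper_mul u₁ u₂) u₃
  have hw00 : (w : Mat p 2) 0 0 = 1 := by
    rw [hw_def, upper_mul_apply00 u₃, upper_mul_apply00 u₂, hx]
  have hw11 : (w : Mat p 2) 1 1 = 1 := by
    rw [hw_def, upper_mul_apply11 (upper_mul u₁ u₂), upper_mul_apply11 u₁, hz]
  have hwH : w ∈ H₁ := by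
    rw [eq_unipUpper_of_entries w hw10 hw00 rfl hw11]; exact hU _
  have hprod : w⁻¹ * a₁ * a₂ * a₃ = 1 := by
    rw [mul_assoc (w⁻¹ * a₁), mul_assoc w⁻¹, ← mul_assoc a₁, ← hw_def, inv_mul_cancel]
  obtain ⟨h1, h2, h3⟩ := htpp (w⁻¹ * a₁) (H₁.mul_mem (H₁.inv_mem hwH) ha₁) a₂ ha₂ a₃ ha₃ hprod
  have ha₁w : a₁ = w := (inv_mul_eq_one.mp h1).symm
  exact ⟨h2, h3, by rw [ha₁w, hw00], by rw [ha₁w, hw11]⟩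

/-- Diagonal entries of elements of an upper-triangular subgroup are non-zero. -/
theorem mem_diag_ne_zero {H : Subgroup (GLm p 2)} (hH : ∀ h ∈ H, (h : Mat p 2) 1 0 = 0) (h : H) :
    ((h : GLm p 2) : Mat p 2) 0 0 ≠ 0 ∧ ((h : GLm p 2) : Mat p 2) 1 1 ≠ 0 :=
  upper_diag_ne_zero _ (hH h.1 h.2)

/-- **Case A** — no `Hᵢ` contains a non-trivial unipotent: `|H₁||H₂||H₃| ≤ (p-1)⁴`, by the
injection `(h₁,h₂,h₃) ↦ (z₁/x₁, z₂/x₂, z₃/x₃, x₁x₂x₃)` into `(𝔽_pˣ)⁴` (`xᵢ = (hᵢ)₀₀`,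
`zᵢ = (hᵢ)₁₁`);
injectivity is key lemma A applied to `aᵢ = hᵢ'⁻¹ hᵢ`. -/
theorem volume_le_of_noUnipotent {H₁ H₂ H₃ : Subgroup (GLm p 2)}
    (hH₁ : ∀ h ∈ H₁, (h : Mat p 2) 1 0 = 0) (hH₂ : ∀ h ∈ H₂, (h : Mat p 2) 1 0 = 0)
    (hH₃ : ∀ h ∈ H₃, (h : Mat p 2) 1 0 = 0)
    (hA₁ : ∀ h ∈ H₁, (h : Mat p 2) 0 0 = 1 → (h : Mat p 2) 1 1 = 1 → h = 1)
    (hA₂ : ∀ h ∈ H₂, (h : Mat p 2) 0 0 = 1 → (h : Mat p 2) 1 1 = 1 → h = 1)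
    (hA₃ : ∀ h ∈ H₃, (h : Mat p 2) 0 0 = 1 → (h : Mat p 2) 1 1 = 1 → h = 1)
    (htpp : SubgroupTPP H₁ H₂ H₃) :
    Nat.card H₁ * Nat.card H₂ * Nat.card H₃ ≤ (p - 1) ^ 4 := by
  let r : ∀ {H : Subgroup (GLm p 2)}, (∀ h ∈ H, (h : Mat p 2) 1 0 = 0) → H → (ZMod p)ˣ :=
    fun hH h => Units.mk0 (((h : GLm p 2) : Mat p 2) 1 1 / ((h : GLm p 2) : Mat p 2) 0 0)
      (div_ne_zero (mem_diag_ne_zero hH h).2 (mem_diag_ne_zero hH h).1)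
  let Φ : H₁ × H₂ × H₃ → (ZMod p)ˣ × (ZMod p)ˣ × (ZMod p)ˣ × (ZMod p)ˣ := fun t =>
    (r hH₁ t.1, r hH₂ t.2.1, r hH₃ t.2.2,
      Units.mk0 (((t.1 : GLm p 2) : Mat p 2) 0 0 * ((t.2.1 : GLm p 2) : Mat p 2) 0 0 *
        ((t.2.2 : GLm p 2) : Mat p 2) 0 0) (mul_ne_zero (mul_ne_zero (mem_diag_ne_zero hH₁ t.1).1
          (mem_diag_ne_zero hH₂ t.2.1).1) (mem_diag_ne_zero hH₃ t.2.2).1))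
  have sc : ∀ {H : Subgroup (GLm p 2)} (hH : ∀ h ∈ H, (h : Mat p 2) 1 0 = 0) (h h' : H),
      r hH h = r hH h' → (((h'⁻¹ * h : H) : GLm p 2) : Mat p 2) 0 0 =
        (((h'⁻¹ * h : H) : GLm p 2) : Mat p 2) 1 1 := by
    intro H hH h h' hrr
    have e : ((h : GLm p 2) : Mat p 2) 1 1 / ((h : GLm p 2) : Mat p 2) 0 0 =
        ((h' : GLm p 2) : Mat p 2) 1 1 / ((h' : GLm p 2) : Mat p 2) 0 0 := by
      simpa [r] using congrArg (fun u : (ZMod p)ˣ => (u : ZMod p)) hrr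
    obtain ⟨hx, hz⟩ := mem_diag_ne_zero hH h
    obtain ⟨hx', hz'⟩ := mem_diag_ne_zero hH h'
    rw [(quot_apply hH h h').1, (quot_apply hH h h').2]
    rw [div_eq_div_iff hx hx'] at e
    field_simp
    linear_combination -e
  have hΦ : Function.Injective Φ := by
    rintro ⟨h₁, h₂, h₃⟩ ⟨h₁', h₂', h₃'⟩ hΦeq
    simp only [Φ, Prod.mk.injEq] at hΦeq
    obtain ⟨e₁, e₂, e₃, e₄⟩ := hΦeq
    have e₄' := congrArg (fun u : (ZMod p)ˣ => (u : ZMod p)) e₄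
    simp only [Units.val_mk0] at e₄'
    have hprod : (((h₁'⁻¹ * h₁ : H₁) : GLm p 2) : Mat p 2) 0 0 *
        (((h₂'⁻¹ * h₂ : H₂) : GLm p 2) : Mat p 2) 0 0 *
        (((h₃'⁻¹ * h₃ : H₃) : GLm p 2) : Mat p 2) 0 0 = 1 := by
      rw [(quot_apply hH₁ h₁ h₁').1, (quot_apply hH₂ h₂ h₂').1, (quot_apply hH₃ h₃ h₃').1]
      have := (mem_diag_ne_zero hH₁ h₁').1
      have := (mem_diag_ne_zero hH₂ h₂').1
      have := (mem_diag_ne_zero hH₃ h₃').1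
      field_simp
      linear_combination e₄'
    obtain ⟨k₁, k₂, k₃⟩ := key_noUnipotent hH₁ hH₂ hH₃ hA₁ hA₂ hA₃ htpp (h₁'⁻¹ * h₁).2
      (h₂'⁻¹ * h₂).2 (h₃'⁻¹ * h₃).2 (sc hH₁ h₁ h₁' e₁) (sc hH₂ h₂ h₂' e₂) (sc hH₃ h₃ h₃' e₃) hprod
    have j₁ : h₁ = h₁' := (inv_mul_eq_one.mp (Subtype.ext k₁ : h₁'⁻¹ * h₁ = 1)).symm
    have j₂ : h₂ = h₂' := (inv_mul_eq_one.mp (Subtype.ext k₂ : h₂'⁻¹ * h₂ = 1)).symm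
    have j₃ : h₃ = h₃' := (inv_mul_eq_one.mp (Subtype.ext k₃ : h₃'⁻¹ * h₃ = 1)).symm
    rw [j₁, j₂, j₃]
  calc Nat.card H₁ * Nat.card H₂ * Nat.card H₃ = Nat.card (H₁ × H₂ × H₃) := by
        rw [Nat.card_prod, Nat.card_prod, mul_assoc]
    _ ≤ Nat.card ((ZMod p)ˣ × (ZMod p)ˣ × (ZMod p)ˣ × (ZMod p)ˣ) :=
        Nat.card_le_card_of_injective Φ hΦ
    _ = (p - 1) ^ 4 := by simp only [Nat.card_prod, natCard_units]; ring

/-- **Case B** — `H₁` contains a non-trivial unipotent (hence all of `U`): `|H₁||H₂||H₃| ≤ p(p-1)²`,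
by the injection `(h₁,h₂,h₃) ↦ (x₁x₂x₃, z₁z₂z₃, (h₁)₀₁)` into `𝔽_pˣ × 𝔽_pˣ × 𝔽_p`; injectivity is
key lemma B applied to `aᵢ = hᵢ'⁻¹ hᵢ`. -/
theorem volume_le_of_unipotent {H₁ H₂ H₃ : Subgroup (GLm p 2)}
    (hH₁ : ∀ h ∈ H₁, (h : Mat p 2) 1 0 = 0) (hH₂ : ∀ h ∈ H₂, (h : Mat p 2) 1 0 = 0)
    (hH₃ : ∀ h ∈ H₃, (h : Mat p 2) 1 0 = 0)
    (hB : ∃ g ∈ H₁, (g : Mat p 2) 0 0 = 1 ∧ (g : Mat p 2) 1 1 = 1 ∧ g ≠ 1)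
    (htpp : SubgroupTPP H₁ H₂ H₃) :
    Nat.card H₁ * Nat.card H₂ * Nat.card H₃ ≤ p * (p - 1) ^ 2 := by
  obtain ⟨g, hgH, hg00, hg11, hg1⟩ := hB
  have hU : ∀ y : ZMod p, unipUpper y ∈ H₁ :=
    unipUpper_mem_of_mem hgH (hH₁ g hgH) hg00 hg11 hg1
  let Ψ : H₁ × H₂ × H₃ → (ZMod p)ˣ × (ZMod p)ˣ × ZMod p := fun t =>
    (Units.mk0 (((t.1 : GLm p 2) : Mat p 2) 0 0 * ((t.2.1 : GLm p 2) : Mat p 2) 0 0 *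
        ((t.2.2 : GLm p 2) : Mat p 2) 0 0) (mul_ne_zero (mul_ne_zero (mem_diag_ne_zero hH₁ t.1).1
          (mem_diag_ne_zero hH₂ t.2.1).1) (mem_diag_ne_zero hH₃ t.2.2).1),
     Units.mk0 (((t.1 : GLm p 2) : Mat p 2) 1 1 * ((t.2.1 : GLm p 2) : Mat p 2) 1 1 *
        ((t.2.2 : GLm p 2) : Mat p 2) 1 1) (mul_ne_zero (mul_ne_zero (mem_diag_ne_zero hH₁ t.1).2
          (mem_diag_ne_zero hH₂ t.2.1).2) (mem_diag_ne_zero hH₃ t.2.2).2),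
     ((t.1 : GLm p 2) : Mat p 2) 0 1)
  have hΨ : Function.Injective Ψ := by
    rintro ⟨h₁, h₂, h₃⟩ ⟨h₁', h₂', h₃'⟩ hΨeq
    simp only [Ψ, Prod.mk.injEq] at hΨeq
    obtain ⟨e₁, e₂, e₃⟩ := hΨeq
    have e₁' := congrArg (fun u : (ZMod p)ˣ => (u : ZMod p)) e₁
    have e₂' := congrArg (fun u : (ZMod p)ˣ => (u : ZMod p)) e₂
    simp only [Units.val_mk0] at e₁' e₂'
    obtain ⟨x₁, z₁⟩ := quot_apply hH₁ h₁ h₁'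
    obtain ⟨x₂, z₂⟩ := quot_apply hH₂ h₂ h₂'
    obtain ⟨x₃, z₃⟩ := quot_apply hH₃ h₃ h₃'
    obtain ⟨n₁, m₁⟩ := mem_diag_ne_zero hH₁ h₁'
    obtain ⟨n₂, m₂⟩ := mem_diag_ne_zero hH₂ h₂'
    obtain ⟨n₃, m₃⟩ := mem_diag_ne_zero hH₃ h₃'
    have hx : (((h₁'⁻¹ * h₁ : H₁) : GLm p 2) : Mat p 2) 0 0 *
        (((h₂'⁻¹ * h₂ : H₂) : GLm p 2) : Mat p 2) 0 0 *
        (((h₃'⁻¹ * h₃ : H₃) : GLm p 2) : Mat p 2) 0 0 = 1 := by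
      rw [x₁, x₂, x₃]; field_simp; linear_combination e₁'
    have hz : (((h₁'⁻¹ * h₁ : H₁) : GLm p 2) : Mat p 2) 1 1 *
        (((h₂'⁻¹ * h₂ : H₂) : GLm p 2) : Mat p 2) 1 1 *
        (((h₃'⁻¹ * h₃ : H₃) : GLm p 2) : Mat p 2) 1 1 = 1 := by
      rw [z₁, z₂, z₃]; field_simp; linear_combination e₂'
    obtain ⟨k₂, k₃, a00, a11⟩ := key_unipotent hH₁ hH₂ hH₃ hU htpp (h₁'⁻¹ * h₁).2
      (h₂'⁻¹ * h₂).2 (h₃'⁻¹ * h₃).2 hx hz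
    rw [x₁] at a00
    rw [z₁] at a11
    have j₂ : h₂ = h₂' := (inv_mul_eq_one.mp (Subtype.ext k₂ : h₂'⁻¹ * h₂ = 1)).symm
    have j₃ : h₃ = h₃' := (inv_mul_eq_one.mp (Subtype.ext k₃ : h₃'⁻¹ * h₃ = 1)).symm
    have j₁ : h₁ = h₁' := Subtype.ext (upper_ext (hH₁ _ h₁.2) (hH₁ _ h₁'.2)
      ((inv_mul_eq_one₀ n₁).mp a00).symm e₃ ((inv_mul_eq_one₀ m₁).mp a11).symm)
    rw [j₁, j₂, j₃]
  calc Nat.card H₁ * Nat.card H₂ * Nat.card H₃ = Nat.card (H₁ × H₂ × H₃) := by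
        rw [Nat.card_prod, Nat.card_prod, mul_assoc]
    _ ≤ Nat.card ((ZMod p)ˣ × (ZMod p)ˣ × ZMod p) := Nat.card_le_card_of_injective Ψ hΨ
    _ = p * (p - 1) ^ 2 := by simp only [Nat.card_prod, natCard_units, Nat.card_zmod]; ring

/-- `p (p-1)² ≤ (p-1)⁴` for `p ≥ 3`. -/
theorem aux_mul_sq_le_pow_four (hp : 3 ≤ p) : p * (p - 1) ^ 2 ≤ (p - 1) ^ 4 := by
  obtain ⟨q, rfl⟩ : ∃ q, p = q + 1 := ⟨p - 1, by omega⟩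
  have hq : 2 ≤ q := by omega
  rw [Nat.add_sub_cancel]
  have hq2 : q + 1 ≤ q ^ 2 := by nlinarith
  calc (q + 1) * q ^ 2 ≤ q ^ 2 * q ^ 2 := Nat.mul_le_mul_right _ hq2
    _ = q ^ 4 := by ring

/-- **VOLUME CEILING FOR BOREL TRIPLES.**  For a prime `p ≥ 3` and subgroups `H₁, H₂, H₃` of the
upper Borel of `GL₂(𝔽_p)` with the subgroup triple product property,
`|H₁| |H₂| |H₃| ≤ (p - 1)⁴`.  (At `p = 2` the triple `(U, 1, 1)` has volume `2`.) -/
theorem borel_tpp_volume_le {H₁ H₂ H₃ : Subgroup (GLm p 2)}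
    (hH₁ : ∀ h ∈ H₁, (h : Mat p 2) 1 0 = 0) (hH₂ : ∀ h ∈ H₂, (h : Mat p 2) 1 0 = 0)
    (hH₃ : ∀ h ∈ H₃, (h : Mat p 2) 1 0 = 0) (htpp : SubgroupTPP H₁ H₂ H₃) (hp : 3 ≤ p) :
    Nat.card H₁ * Nat.card H₂ * Nat.card H₃ ≤ (p - 1) ^ 4 := by
  have hB := aux_mul_sq_le_pow_four (p := p) hp
  by_cases hA₁ : ∀ h ∈ H₁, (h : Mat p 2) 0 0 = 1 → (h : Mat p 2) 1 1 = 1 → h = 1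
  · by_cases hA₂ : ∀ h ∈ H₂, (h : Mat p 2) 0 0 = 1 → (h : Mat p 2) 1 1 = 1 → h = 1
    · by_cases hA₃ : ∀ h ∈ H₃, (h : Mat p 2) 0 0 = 1 → (h : Mat p 2) 1 1 = 1 → h = 1
      · exact volume_le_of_noUnipotent hH₁ hH₂ hH₃ hA₁ hA₂ hA₃ htpp
      · push Not at hA₃
        obtain ⟨g, hg, h00, h11, hg1⟩ := hA₃
        have := volume_le_of_unipotent hH₃ hH₁ hH₂ ⟨g, hg, h00, h11, hg1⟩ htpp.rotate.rotate
        calc Nat.card H₁ * Nat.card H₂ * Nat.card H₃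
            = Nat.card H₃ * Nat.card H₁ * Nat.card H₂ := by ring
          _ ≤ (p - 1) ^ 4 := this.trans hB
    · push Not at hA₂
      obtain ⟨g, hg, h00, h11, hg1⟩ := hA₂
      have := volume_le_of_unipotent hH₂ hH₃ hH₁ ⟨g, hg, h00, h11, hg1⟩ htpp.rotate
      calc Nat.card H₁ * Nat.card H₂ * Nat.card H₃
          = Nat.card H₂ * Nat.card H₃ * Nat.card H₁ := by ring
        _ ≤ (p - 1) ^ 4 := this.trans hB
  · push Not at hA₁
    obtain ⟨g, hg, h00, h11, hg1⟩ := hA₁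
    exact (volume_le_of_unipotent hH₁ hH₂ hH₃ ⟨g, hg, h00, h11, hg1⟩ htpp).trans hB

end VolumeBound

end Summit.MatrixMultiplication.MatrixMultiplication.Theorems.SubgroupIdentityDesigns.Negative
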